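/-
Copyright (c) 2026 the pub-hodgecm-mathlib formalisation cell (harness21).  Prover seat hodgecm-mathlib-K2E4-p11 (g5), Track B ∕ K2-LIT, h413 =
`stmt-HodgeConjecture-24833`, line `K2_E1_TraceFormulaBeta`, campaign «EIS-RANK-ONE» ∕ R8-LADDER-3, «MS-3» (dealer K2E1-plan (g6) DEAL (4) 2026-09-04T09:52:04Z «MS-3 = N = 3 twin
of ★ p858755 + lower twin ★ p858922 at (σ₀, ρ₀) = (2, 2), hypothesis-first on the closer₃ letters»): THE MAASS–SELBERG RELATION OF THE SPHERICAL SECTION OF `U(2,1)` CONTINUED —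
pole control of the continued intertwining scalar `c̃` on `{Re z > 1} ∖ ℝ`, MODULO the sesqui-holomorphic pairing.
-/
import Summits.HodgeConjecture.HodgeConjecture.Theorems.K2E1MaassSelbergContinuedCMTwo   -- ★ p858755: §0 Schwarz reflection, §1 identity theorem (both rank-free); ★ `poleControl_of_fourTerm`, ★ `conj_ofReal_cpow`
import HarnessLib

/-!
# h413 ∕ Track B «K2-LIT», R8-LADDER-3 «MS-3» — `K2E1MaassSelbergContinuedCMThree`: the spherical Maass–Selberg relation of `U(2,1)∕CM` CONTINUED to `1 < Re z` by the identity
# theorem, and pole control of the continued `c̃` on `{Re z > 1} ∖ ℝ` (both quadrants) — modulo the sesqui-holomorphic pairing `Φ` (the closer₃ letters)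

Cell `pub/hodgecm-mathlib`, crux H413 = `stmt-HodgeConjecture-24833`, route `HCCMUnconditional`; dealer K2E1-plan (g6) DEAL (4) 09:52:04Z.  THEOREMS ONLY (no `def`, no `instance`, no `notation`,
no `sorry`); ONE named input (`Φ`, the pairing `⟨Λ^TẼ(z), Λ^TẼ(z′)⟩` of the CONTINUED `U(2,1)` Eisenstein series — σ1₃+σ2₃, the closer₃ letters); lane `--kind proof --supports
stmt-HodgeConjecture-24833 --as helper`.  This is the N = 3 TWIN of ★ p858755 `K2E1MaassSelbergContinuedCMTwo` + ★ p858922 `…Lower` at `(σ₀, ρ₀) = (2, 2)`: Godement half-plane `Re z > 2`,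
line of symmetry `Re z = 1`, `s₁ = z + conj z′ − 2`, `s₂ = z − conj z′`, `x = Re z − 1` (★ (R6k)₃ `maassSelberg_flatSectionU_cm_three_final_const`, ★ `add_conj_sub_two_eq`); the rank-free
§0 (Schwarz reflection) and §1 (two-variable identity theorem) of ★ p858755 are IMPORTED, not restated.
THE MATHEMATICS ([MoeglinWaldspurger1995, IV.2.3, IV.3.12]).  `R₃(z,z′) = cμ·K·( T^{s₁}∕s₁·κm|φ₀|² + T^{s₂}∕s₂·κm φ₀ conj(c(z′)φ₀) − T^{−s₂}∕s₂·κm c(z)φ₀ conj φ₀ − T^{−s₁}∕s₁·κm c(z)φ₀ conj(c(z′)φ₀) )`.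
For `c̃` holomorphic on `D⁺ = {Re > 1, Im > 0}` and `Φ` holomorphic in `z`, antiholomorphic in `z′` there, `Φ = R₃(·,·;c̃)` persists from the sub-tube `2 < Re z′ < Re z` to all of `D⁺ × D⁺`
(`2 ∉ {Re(z + conj z′)}`-singularities absent: `Re(z + conj z′ − 2) > 0`, `Im(z − conj z′) > 0`), and at the diagonal ★ `poleControl_of_fourTerm` (`s₁ = 2x`, `x = Re z − 1 > 0`) gives
(a1)∧(a2)∧(a3): **`c̃` HAS NO POLE ON `1 < Re z ≤ 2` OFF THE REAL AXIS and is `O(|y|⁻¹)` on vertical approach**; §4 transfers this to `D⁻` by Schwarz reflection exactly as ★ p858922.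
* §2 `isOpen∕isPreconnected_upper∕lowerQuadrant_one`, `add_sub_two_ne_zero_and_sub_ne_zero`, `differentiableOn_fourTerm_fst ∕ _snd_conj` (N = 3 exponents).
* §3 HEAD **`poleControl_continued_cm_three_of_pairing`** — (a1)∧(a2)∧(a3) for `c̃` at every `z ∈ D⁺`, modulo `Φ`.
* §4 `conj_mem_lower∕upperQuadrant_one`, HEAD **`poleControl_continued_cm_three_of_pairing_lower`** on `D⁻`.
SOCKET (verbatim binders `hΦ₁ hΦ₂ hrel hQ`, as at N = 2 with `½ ↦ 1`, `1 ↦ 2`): supplied by the closer₃ ∕ σ2₃ dominated-convergence facts and ★ (R6k)₃.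
HONEST LABEL.  Count-neutral helper; proves no printed statement; conditional on the named pairing `Φ`; HC_CM is proved only modulo the 7 printed citations (2 remaining named
inputs: hLiu418 = `stmt-HodgeConjecture-24832`, h413 = `stmt-HodgeConjecture-24833`) until rung 0 closes.

## References
* [MoeglinWaldspurger1995] C. Mœglin, J.-L. Waldspurger, *Spectral decomposition and Eisenstein series* (1995), IV.2.3 (Maass–Selberg), IV.3.12 (a) (pole control; continuation argument).
* [Garrett2018] P. Garrett, *Modern Analysis of Automorphic Forms by Example* 1 (2018), §1.12, §11.3.
* [Arthur1980TraceFormulaII] J. Arthur, *A trace formula for reductive groups II*, Compositio Math. 40 (1980), §4.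
-/

set_option autoImplicit false
set_option linter.dupNamespace false  -- the mandated namespace repeats the summit's segment (`HodgeConjecture.HodgeConjecture`)

noncomputable section

open Filter Topology Set Asymptotics
open scoped ComplexConjugate
open Summit.HodgeConjecture.HodgeConjecture.Cruxes.H413.K2E1MaassSelbergPoleControl (poleControl_of_fourTerm)
open Summit.HodgeConjecture.HodgeConjecture.Cruxes.H413.K2E1MaassSelbergContinuedCMTwo (differentiableOn_conj_comp_conj eqOn_prod_of_separately_differentiableOn)

namespace Summit.HodgeConjecture.HodgeConjecture.Cruxes.H413.K2E1MaassSelbergContinuedCMThree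

/-! ## §2 The four-term right side `R(z, z′; c̃)` on the quadrants -/

section FourTerm

/-- The upper quadrant `D⁺ = {Re > 1, Im > 0}` is open. [folklore] -/
theorem isOpen_upperQuadrant_one : IsOpen {z : ℂ | 1 < z.re ∧ 0 < z.im} :=
  (isOpen_lt continuous_const Complex.continuous_re).inter (isOpen_lt continuous_const Complex.continuous_im)

/-- The lower quadrant `D⁻ = {Re > 1, Im < 0}` is open. [folklore] -/
theorem isOpen_lowerQuadrant_one : IsOpen {w : ℂ | 1 < w.re ∧ w.im < 0} :=
  (isOpen_lt continuous_const Complex.continuous_re).inter (isOpen_lt Complex.continuous_im continuous_const)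

/-- `D⁺` is convex, hence preconnected. [folklore] -/
theorem isPreconnected_upperQuadrant_one : IsPreconnected {z : ℂ | 1 < z.re ∧ 0 < z.im} := by
  have h : Convex ℝ {z : ℂ | 1 < z.re ∧ 0 < z.im} := by
    have h1 : Convex ℝ {z : ℂ | 1 < z.re} := convex_halfSpace_gt Complex.reLm.isLinear _
    have h2 : Convex ℝ {z : ℂ | 0 < z.im} := convex_halfSpace_gt Complex.imLm.isLinear _
    exact h1.inter h2
  exact h.isPreconnected

/-- `D⁻` is convex, hence preconnected. [folklore] -/
theorem isPreconnected_lowerQuadrant_one : IsPreconnected {w : ℂ | 1 < w.re ∧ w.im < 0} := by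
  have h : Convex ℝ {w : ℂ | 1 < w.re ∧ w.im < 0} := by
    have h1 : Convex ℝ {w : ℂ | 1 < w.re} := convex_halfSpace_gt Complex.reLm.isLinear _
    have h2 : Convex ℝ {w : ℂ | w.im < 0} := convex_halfSpace_lt Complex.imLm.isLinear _
    exact h1.inter h2
  exact h.isPreconnected

/-- On `D⁺ × D⁻` (second variable `w = conj z′`): `z + w − 2 ≠ 0` and `z − w ≠ 0` (`Re(z + w) > 2`, `Im(z − w) > 0`). [folklore] -/
theorem add_sub_two_ne_zero_and_sub_ne_zero {z w : ℂ} (hz : z ∈ {z : ℂ | 1 < z.re ∧ 0 < z.im}) (hw : w ∈ {w : ℂ | 1 < w.re ∧ w.im < 0}) : z + w - 2 ≠ 0 ∧ z - w ≠ 0 := by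
  obtain ⟨hz1, hz2⟩ := hz
  obtain ⟨hw1, hw2⟩ := hw
  constructor
  · intro h
    have := congrArg Complex.re h
    simp only [Complex.add_re, Complex.sub_re, Complex.zero_re] at this
    norm_num at this
    linarith
  · intro h
    have := congrArg Complex.im h
    simp only [Complex.sub_im, Complex.zero_im] at this
    linarith

/-- **`R(·, z′; c̃)` is holomorphic in `z ∈ D⁺`** for `z′ ∈ D⁺` and `c̃` holomorphic on `D⁺` (positive base `T`, non-vanishing denominators on `D⁺ × D⁺`). [cite: MoeglinWaldspurger1995, IV.3.12] -/
theorem differentiableOn_fourTerm_fst {T cμ K κ m : ℝ} (hT : 0 < T) (φ₀ : ℂ) {c : ℂ → ℂ} (hc : DifferentiableOn ℂ c {z : ℂ | 1 < z.re ∧ 0 < z.im}) {z' : ℂ} (hz' : z' ∈ {z : ℂ | 1 < z.re ∧ 0 < z.im}) :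
    DifferentiableOn ℂ (fun z : ℂ =>
      ((cμ : ℝ) : ℂ) * (((K : ℝ) : ℂ) *
        ((((T : ℝ) : ℂ) ^ (z + conj z' - 2) / (z + conj z' - 2)) * (((κ : ℝ) : ℂ) * (((m : ℝ) : ℂ) * (φ₀ * conj φ₀)))
          + (((T : ℝ) : ℂ) ^ (z - conj z') / (z - conj z')) * (((κ : ℝ) : ℂ) * (((m : ℝ) : ℂ) * (φ₀ * conj (c z' * φ₀))))
          - (((T : ℝ) : ℂ) ^ (-(z - conj z')) / (z - conj z')) * (((κ : ℝ) : ℂ) * (((m : ℝ) : ℂ) * (c z * φ₀ * conj φ₀)))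
          - (((T : ℝ) : ℂ) ^ (-(z + conj z' - 2)) / (z + conj z' - 2)) * (((κ : ℝ) : ℂ) * (((m : ℝ) : ℂ) * (c z * φ₀ * conj (c z' * φ₀))))))) {z : ℂ | 1 < z.re ∧ 0 < z.im} := by
  have hT0 : ((T : ℝ) : ℂ) ≠ 0 := Complex.ofReal_ne_zero.2 hT.ne'
  have hw : conj z' ∈ {w : ℂ | 1 < w.re ∧ w.im < 0} := by
    obtain ⟨h1, h2⟩ := hz'
    refine ⟨?_, ?_⟩
    · show 1 < (conj z').re
      rw [Complex.conj_re]; exact h1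
    · show (conj z').im < 0
      rw [Complex.conj_im]; linarith
  have hne : ∀ z ∈ {z : ℂ | 1 < z.re ∧ 0 < z.im}, z + conj z' - 2 ≠ 0 ∧ z - conj z' ≠ 0 := fun z hz => add_sub_two_ne_zero_and_sub_ne_zero hz hw
  have hs₁ : DifferentiableOn ℂ (fun z : ℂ => z + conj z' - 2) {z : ℂ | 1 < z.re ∧ 0 < z.im} := (differentiableOn_id.add_const _).sub_const _
  have hs₂ : DifferentiableOn ℂ (fun z : ℂ => z - conj z') {z : ℂ | 1 < z.re ∧ 0 < z.im} := differentiableOn_id.sub_const _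
  have e₁ : DifferentiableOn ℂ (fun z : ℂ => ((T : ℝ) : ℂ) ^ (z + conj z' - 2) / (z + conj z' - 2)) {z : ℂ | 1 < z.re ∧ 0 < z.im} :=
    (hs₁.const_cpow (Or.inl hT0)).div hs₁ fun z hz => (hne z hz).1
  have e₂ : DifferentiableOn ℂ (fun z : ℂ => ((T : ℝ) : ℂ) ^ (z - conj z') / (z - conj z')) {z : ℂ | 1 < z.re ∧ 0 < z.im} :=
    (hs₂.const_cpow (Or.inl hT0)).div hs₂ fun z hz => (hne z hz).2
  have e₃ : DifferentiableOn ℂ (fun z : ℂ => ((T : ℝ) : ℂ) ^ (-(z - conj z')) / (z - conj z')) {z : ℂ | 1 < z.re ∧ 0 < z.im} :=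
    (hs₂.neg.const_cpow (Or.inl hT0)).div hs₂ fun z hz => (hne z hz).2
  have e₄ : DifferentiableOn ℂ (fun z : ℂ => ((T : ℝ) : ℂ) ^ (-(z + conj z' - 2)) / (z + conj z' - 2)) {z : ℂ | 1 < z.re ∧ 0 < z.im} :=
    (hs₁.neg.const_cpow (Or.inl hT0)).div hs₁ fun z hz => (hne z hz).1
  exact (((((e₁.mul_const _).add (e₂.mul_const _)).sub (e₃.mul (((hc.mul_const _).mul_const _).const_mul _ |>.const_mul _))).sub
    (e₄.mul (((hc.mul_const _).mul_const _).const_mul _ |>.const_mul _))).const_mul _).const_mul _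

/-- **`R(z, conj w; c̃)` is holomorphic in `w ∈ D⁻`** for `z ∈ D⁺` (the antiholomorphy of `R` in `z′`; Schwarz reflection ★ p858755 §0 for `conj(c̃(z′)) = conj(c̃(conj w))`).
[cite: MoeglinWaldspurger1995, IV.3.12] -/
theorem differentiableOn_fourTerm_snd_conj {T cμ K κ m : ℝ} (hT : 0 < T) (φ₀ : ℂ) {c : ℂ → ℂ} (hc : DifferentiableOn ℂ c {z : ℂ | 1 < z.re ∧ 0 < z.im}) {z : ℂ} (hz : z ∈ {z : ℂ | 1 < z.re ∧ 0 < z.im}) :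
    DifferentiableOn ℂ (fun w : ℂ =>
      ((cμ : ℝ) : ℂ) * (((K : ℝ) : ℂ) *
        ((((T : ℝ) : ℂ) ^ (z + w - 2) / (z + w - 2)) * (((κ : ℝ) : ℂ) * (((m : ℝ) : ℂ) * (φ₀ * conj φ₀)))
          + (((T : ℝ) : ℂ) ^ (z - w) / (z - w)) * (((κ : ℝ) : ℂ) * (((m : ℝ) : ℂ) * (φ₀ * conj (c (conj w) * φ₀))))
          - (((T : ℝ) : ℂ) ^ (-(z - w)) / (z - w)) * (((κ : ℝ) : ℂ) * (((m : ℝ) : ℂ) * (c z * φ₀ * conj φ₀)))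
          - (((T : ℝ) : ℂ) ^ (-(z + w - 2)) / (z + w - 2)) * (((κ : ℝ) : ℂ) * (((m : ℝ) : ℂ) * (c z * φ₀ * conj (c (conj w) * φ₀))))))) {w : ℂ | 1 < w.re ∧ w.im < 0} := by
  have hT0 : ((T : ℝ) : ℂ) ≠ 0 := Complex.ofReal_ne_zero.2 hT.ne'
  have hne : ∀ w ∈ {w : ℂ | 1 < w.re ∧ w.im < 0}, z + w - 2 ≠ 0 ∧ z - w ≠ 0 := fun w hw => add_sub_two_ne_zero_and_sub_ne_zero hz hw
  have hs₁ : DifferentiableOn ℂ (fun w : ℂ => z + w - 2) {w : ℂ | 1 < w.re ∧ w.im < 0} := ((differentiableOn_const z).add differentiableOn_id).sub_const _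
  have hs₂ : DifferentiableOn ℂ (fun w : ℂ => z - w) {w : ℂ | 1 < w.re ∧ w.im < 0} := (differentiableOn_const z).sub differentiableOn_id
  have e₁ : DifferentiableOn ℂ (fun w : ℂ => ((T : ℝ) : ℂ) ^ (z + w - 2) / (z + w - 2)) {w : ℂ | 1 < w.re ∧ w.im < 0} :=
    (hs₁.const_cpow (Or.inl hT0)).div hs₁ fun w hw => (hne w hw).1
  have e₂ : DifferentiableOn ℂ (fun w : ℂ => ((T : ℝ) : ℂ) ^ (z - w) / (z - w)) {w : ℂ | 1 < w.re ∧ w.im < 0} :=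
    (hs₂.const_cpow (Or.inl hT0)).div hs₂ fun w hw => (hne w hw).2
  have e₃ : DifferentiableOn ℂ (fun w : ℂ => ((T : ℝ) : ℂ) ^ (-(z - w)) / (z - w)) {w : ℂ | 1 < w.re ∧ w.im < 0} :=
    (hs₂.neg.const_cpow (Or.inl hT0)).div hs₂ fun w hw => (hne w hw).2
  have e₄ : DifferentiableOn ℂ (fun w : ℂ => ((T : ℝ) : ℂ) ^ (-(z + w - 2)) / (z + w - 2)) {w : ℂ | 1 < w.re ∧ w.im < 0} :=
    (hs₁.neg.const_cpow (Or.inl hT0)).div hs₁ fun w hw => (hne w hw).1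
  -- the reflected scalar `w ↦ conj (c̃ (conj w) · φ₀)` is holomorphic on `D⁻`
  have hcs : DifferentiableOn ℂ (fun w : ℂ => conj (c (conj w) * φ₀)) {w : ℂ | 1 < w.re ∧ w.im < 0} := by
    have h := differentiableOn_conj_comp_conj isOpen_upperQuadrant_one hc
    have hsub : {w : ℂ | 1 < w.re ∧ w.im < 0} ⊆ {u : ℂ | conj u ∈ {z : ℂ | 1 < z.re ∧ 0 < z.im}} := fun w hw => by
      obtain ⟨h1, h2⟩ := hw
      refine ⟨?_, ?_⟩
      · show 1 < (conj w).re
        rw [Complex.conj_re]; exact h1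
      · show 0 < (conj w).im
        rw [Complex.conj_im]; linarith
    have h' : DifferentiableOn ℂ (fun w : ℂ => conj (c (conj w)) * conj φ₀) {w : ℂ | 1 < w.re ∧ w.im < 0} := (h.mono hsub).mul_const _
    refine h'.congr fun w _ => ?_
    rw [map_mul]
  exact (((((e₁.mul_const _).add (e₂.mul ((hcs.const_mul _).const_mul _ |>.const_mul _))).sub (e₃.mul_const _)).sub
    (e₄.mul ((hcs.const_mul _).const_mul _ |>.const_mul _))).const_mul _).const_mul _

end FourTerm

/-! ## §3 Pole control of the continued intertwining scalar of `U(2,1)` on `1 < Re z`, `Im z ≠ 0`, modulo the pairing -/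

section Head

/-- **MS-3 (σ3′+σ4′)₃ — THE SPHERICAL MAASS–SELBERG RELATION OF `U(2,1)` CONTINUED, AND POLE CONTROL OF `c̃` ON THE UPPER QUADRANT `D⁺ = {Re z > 1, Im z > 0}`, MODULO THE PAIRING `Φ`.**
Data: `T ≥ 1`; positive constants `cμ, K` (★ (R6k)₃ `maassSelberg_flatSectionU_cm_three_final_const`), `κ` (the idelic bracket, ★ `idelicBracket_pos`), `m = μ_K(K_U)` (★ `measureReal_maximalCompact_pos`); `φ₀ ≠ 0`; the continued
intertwining scalar `c̃`, holomorphic on `D⁺` (★ W5₃-B).  NAMED INPUT (σ1₃+σ2₃ ∕ the closer₃ letters, binders `hΦ₁ hΦ₂ hrel hQ`): a pairing `Φ : ℂ → ℂ → ℂ` — to be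
`⟨Λ^TẼ(z), Λ^TẼ(z′)⟩_{L²(X)}` — holomorphic in `z ∈ D⁺`, with `w ↦ Φ z (conj w)` holomorphic on `D⁻` (antiholomorphy in `z′`), equal to the four-term `R(z,z′;c̃)` of ★ (R6k)₃ `maassSelberg_flatSectionU_cm_three_final_const`
on the sub-tube `2 < Re z′ < Re z` inside `D⁺ × D⁺`, and real non-negative on the diagonal (`Φ z z = Q z ≥ 0`).  THEN for every `z ∈ D⁺`, with `x = Re z − 1`, `y = Im z`,
`a = κm|φ₀|²`, `b = κm|c̃(z)|²|φ₀|²`: (a1) `√b ≤ x·T^{2x}·√a∕|y| + √(x²T^{4x}a∕y² + aT^{4x})`, (a2) the uniform bound on boxes `x ∈ [x₁,x₂]`, `|y| ≥ η`, (a3) `b ≤ (…)²∕y²` for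
`|y| ≤ 1` — [MW] IV.3.12 (a) for the CONTINUED `c̃` on `1 < Re z ≤ 2` (and again on `Re z > 2`).  Proof: ★ p858755 §1 (identity theorem) on `D⁺ × D⁻` in the variables `(z, w = conj z′)` (§2 holomorphy; the
box `{4 < Re < 5} × {2 < Re < 3}` of the sub-tube), then the diagonal `w = conj z` and ★ `poleControl_of_fourTerm`. [cite: MoeglinWaldspurger1995, IV.2.3, IV.3.12 (a)]
[cite: Arthur1980TraceFormulaII, §4] [cite: Garrett2018, §1.12, §11.3] -/
theorem poleControl_continued_cm_three_of_pairing {T cμ K κ m : ℝ} (hT : 1 ≤ T) (hcμ : 0 < cμ) (hK : 0 < K) (hκ : 0 < κ) (hm : 0 < m) {φ₀ : ℂ} (hφ₀ : φ₀ ≠ 0)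
    {c : ℂ → ℂ} (hc : DifferentiableOn ℂ c {z : ℂ | 1 < z.re ∧ 0 < z.im})
    {Φ : ℂ → ℂ → ℂ}
    (hΦ₁ : ∀ z' ∈ {z : ℂ | 1 < z.re ∧ 0 < z.im}, DifferentiableOn ℂ (fun z : ℂ => Φ z z') {z : ℂ | 1 < z.re ∧ 0 < z.im})
    (hΦ₂ : ∀ z ∈ {z : ℂ | 1 < z.re ∧ 0 < z.im}, DifferentiableOn ℂ (fun w : ℂ => Φ z (conj w)) {w : ℂ | 1 < w.re ∧ w.im < 0})
    (hrel : ∀ z ∈ {z : ℂ | 1 < z.re ∧ 0 < z.im}, ∀ z' ∈ {z : ℂ | 1 < z.re ∧ 0 < z.im}, 2 < z'.re → z'.re < z.re →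
      Φ z z' = ((cμ : ℝ) : ℂ) * (((K : ℝ) : ℂ) *
        ((((T : ℝ) : ℂ) ^ (z + conj z' - 2) / (z + conj z' - 2)) * (((κ : ℝ) : ℂ) * (((m : ℝ) : ℂ) * (φ₀ * conj φ₀)))
          + (((T : ℝ) : ℂ) ^ (z - conj z') / (z - conj z')) * (((κ : ℝ) : ℂ) * (((m : ℝ) : ℂ) * (φ₀ * conj (c z' * φ₀))))
          - (((T : ℝ) : ℂ) ^ (-(z - conj z')) / (z - conj z')) * (((κ : ℝ) : ℂ) * (((m : ℝ) : ℂ) * (c z * φ₀ * conj φ₀)))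
          - (((T : ℝ) : ℂ) ^ (-(z + conj z' - 2)) / (z + conj z' - 2)) * (((κ : ℝ) : ℂ) * (((m : ℝ) : ℂ) * (c z * φ₀ * conj (c z' * φ₀)))))))
    {Q : ℂ → ℝ} (hQ : ∀ z ∈ {z : ℂ | 1 < z.re ∧ 0 < z.im}, 0 ≤ Q z ∧ Φ z z = ((Q z : ℝ) : ℂ))
    {z : ℂ} (hz : z ∈ {z : ℂ | 1 < z.re ∧ 0 < z.im}) :
    Real.sqrt (κ * m * ‖c z‖ ^ 2 * ‖φ₀‖ ^ 2) ≤ (z.re - 1) * T ^ (2 * (z.re - 1)) * Real.sqrt (κ * m * ‖φ₀‖ ^ 2) / |z.im| +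
        Real.sqrt ((z.re - 1) ^ 2 * T ^ (4 * (z.re - 1)) * (κ * m * ‖φ₀‖ ^ 2) / z.im ^ 2 + (κ * m * ‖φ₀‖ ^ 2) * T ^ (4 * (z.re - 1))) ∧
      (∀ {x₁ x₂ η : ℝ}, 0 < x₁ → (z.re - 1) ∈ Set.Icc x₁ x₂ → 0 < η → η ≤ |z.im| →
        κ * m * ‖c z‖ ^ 2 * ‖φ₀‖ ^ 2 ≤ (x₂ * T ^ (2 * x₂) * Real.sqrt (κ * m * ‖φ₀‖ ^ 2) / η + Real.sqrt (x₂ ^ 2 * T ^ (4 * x₂) * (κ * m * ‖φ₀‖ ^ 2) / η ^ 2 + (κ * m * ‖φ₀‖ ^ 2) * T ^ (4 * x₂))) ^ 2) ∧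
      (|z.im| ≤ 1 → κ * m * ‖c z‖ ^ 2 * ‖φ₀‖ ^ 2 ≤ ((z.re - 1) * T ^ (2 * (z.re - 1)) * Real.sqrt (κ * m * ‖φ₀‖ ^ 2) +
        Real.sqrt ((z.re - 1) ^ 2 * T ^ (4 * (z.re - 1)) * (κ * m * ‖φ₀‖ ^ 2) + (κ * m * ‖φ₀‖ ^ 2) * T ^ (4 * (z.re - 1)))) ^ 2 / z.im ^ 2) := by
  have hT0 : 0 < T := lt_of_lt_of_le one_pos hT
  -- (1) the identity on `D⁺ × D⁻` in the variables `(z, w = conj z′)`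
  set F : ℂ → ℂ → ℂ := fun z w => Φ z (conj w) with hF_def
  set G : ℂ → ℂ → ℂ := fun z w =>
      ((cμ : ℝ) : ℂ) * (((K : ℝ) : ℂ) *
        ((((T : ℝ) : ℂ) ^ (z + w - 2) / (z + w - 2)) * (((κ : ℝ) : ℂ) * (((m : ℝ) : ℂ) * (φ₀ * conj φ₀)))
          + (((T : ℝ) : ℂ) ^ (z - w) / (z - w)) * (((κ : ℝ) : ℂ) * (((m : ℝ) : ℂ) * (φ₀ * conj (c (conj w) * φ₀))))
          - (((T : ℝ) : ℂ) ^ (-(z - w)) / (z - w)) * (((κ : ℝ) : ℂ) * (((m : ℝ) : ℂ) * (c z * φ₀ * conj φ₀)))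
          - (((T : ℝ) : ℂ) ^ (-(z + w - 2)) / (z + w - 2)) * (((κ : ℝ) : ℂ) * (((m : ℝ) : ℂ) * (c z * φ₀ * conj (c (conj w) * φ₀)))))) with hG_def
  have hconjP : ∀ w ∈ {w : ℂ | 1 < w.re ∧ w.im < 0}, conj w ∈ {z : ℂ | 1 < z.re ∧ 0 < z.im} := fun w hw => by
    obtain ⟨h1, h2⟩ := hw
    refine ⟨?_, ?_⟩
    · show 1 < (conj w).re
      rw [Complex.conj_re]; exact h1
    · show 0 < (conj w).im
      rw [Complex.conj_im]; linarith
  have hF₁ : ∀ w ∈ {w : ℂ | 1 < w.re ∧ w.im < 0}, DifferentiableOn ℂ (fun z => F z w) {z : ℂ | 1 < z.re ∧ 0 < z.im} := fun w hw => hΦ₁ (conj w) (hconjP w hw)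
  have hG₁ : ∀ w ∈ {w : ℂ | 1 < w.re ∧ w.im < 0}, DifferentiableOn ℂ (fun z => G z w) {z : ℂ | 1 < z.re ∧ 0 < z.im} := fun w hw => by
    have h := differentiableOn_fourTerm_fst (cμ := cμ) (K := K) (κ := κ) (m := m) hT0 φ₀ hc (hconjP w hw)
    simp only [Complex.conj_conj] at h
    exact h
  have hF₂ : ∀ z ∈ {z : ℂ | 1 < z.re ∧ 0 < z.im}, DifferentiableOn ℂ (fun w => F z w) {w : ℂ | 1 < w.re ∧ w.im < 0} := fun z hz => hΦ₂ z hz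
  have hG₂ : ∀ z ∈ {z : ℂ | 1 < z.re ∧ 0 < z.im}, DifferentiableOn ℂ (fun w => G z w) {w : ℂ | 1 < w.re ∧ w.im < 0} := fun z hz =>
    differentiableOn_fourTerm_snd_conj (cμ := cμ) (K := K) (κ := κ) (m := m) hT0 φ₀ hc hz
  -- the box of the sub-tube: `O₁ = {4 < Re < 5, Im > 0}`, `O₂ = {2 < Re < 3, Im < 0}` (so `conj w ∈ D⁺`, `2 < Re (conj w) < Re z`)
  have hO₁ : IsOpen {z : ℂ | (4 < z.re ∧ z.re < 5) ∧ 0 < z.im} :=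
    ((isOpen_lt continuous_const Complex.continuous_re).inter (isOpen_lt Complex.continuous_re continuous_const)).inter (isOpen_lt continuous_const Complex.continuous_im)
  have hO₂ : IsOpen {w : ℂ | (2 < w.re ∧ w.re < 3) ∧ w.im < 0} :=
    ((isOpen_lt continuous_const Complex.continuous_re).inter (isOpen_lt Complex.continuous_re continuous_const)).inter (isOpen_lt Complex.continuous_im continuous_const)
  have hO₁ne : ({z : ℂ | (4 < z.re ∧ z.re < 5) ∧ 0 < z.im} : Set ℂ).Nonempty := ⟨⟨9 / 2, 1⟩, by norm_num⟩
  have hO₂ne : ({w : ℂ | (2 < w.re ∧ w.re < 3) ∧ w.im < 0} : Set ℂ).Nonempty := ⟨⟨5 / 2, -1⟩, by norm_num⟩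
  have hO₁D : {z : ℂ | (4 < z.re ∧ z.re < 5) ∧ 0 < z.im} ⊆ {z : ℂ | 1 < z.re ∧ 0 < z.im} := fun z hz => ⟨by linarith [hz.1.1], hz.2⟩
  have hO₂D : {w : ℂ | (2 < w.re ∧ w.re < 3) ∧ w.im < 0} ⊆ {w : ℂ | 1 < w.re ∧ w.im < 0} := fun w hw => ⟨by linarith [hw.1.1], hw.2⟩
  have heq : ∀ z ∈ {z : ℂ | (4 < z.re ∧ z.re < 5) ∧ 0 < z.im}, ∀ w ∈ {w : ℂ | (2 < w.re ∧ w.re < 3) ∧ w.im < 0}, F z w = G z w := by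
    intro z hz w hw
    have h := hrel z (hO₁D hz) (conj w) (hconjP w (hO₂D hw)) (by rw [Complex.conj_re]; exact hw.1.1) (by rw [Complex.conj_re]; linarith [hw.1.2, hz.1.1])
    simp only [Complex.conj_conj] at h
    exact h
  have hid := eqOn_prod_of_separately_differentiableOn isOpen_upperQuadrant_one isPreconnected_upperQuadrant_one isOpen_lowerQuadrant_one isPreconnected_lowerQuadrant_one
    hO₁ hO₁ne hO₁D hO₂ hO₂ne hO₂D hF₁ hG₁ hF₂ hG₂ heq
  -- (2) the diagonal `w = conj z`
  have hzc : conj z ∈ {w : ℂ | 1 < w.re ∧ w.im < 0} := by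
    obtain ⟨h1, h2⟩ := hz
    refine ⟨?_, ?_⟩
    · show 1 < (conj z).re
      rw [Complex.conj_re]; exact h1
    · show (conj z).im < 0
      rw [Complex.conj_im]; linarith
  have hdiag := hid z hz (conj z) hzc
  simp only [hF_def, hG_def, Complex.conj_conj] at hdiag
  obtain ⟨hQ0, hQeq⟩ := hQ z hz
  rw [hQeq] at hdiag
  -- (3) ★ `poleControl_of_fourTerm` with `c₁ = cμ`, `c₂ = K`, `a = κm|φ₀|²`, `b = κm|c̃ z|²|φ₀|²`, `W = κm·φ₀·conj(c̃ z·φ₀)`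
  have hx : 0 < z.re - 1 := by linarith [hz.1]
  have hy : z.im ≠ 0 := ne_of_gt hz.2
  obtain ⟨hs₁, hs₂⟩ : z + conj z - 2 = ((2 * (z.re - 1) : ℝ) : ℂ) ∧ z - conj z = ((2 * z.im : ℝ) : ℂ) * Complex.I :=
    ⟨by rw [Complex.add_conj]; push_cast; ring, Complex.sub_conj z⟩
  have hnorm : φ₀ * conj φ₀ = ((‖φ₀‖ ^ 2 : ℝ) : ℂ) := by rw [Complex.mul_conj, Complex.normSq_eq_norm_sq]
  have ha : 0 < κ * m * ‖φ₀‖ ^ 2 := by positivity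
  have hb : 0 ≤ κ * m * ‖c z‖ ^ 2 * ‖φ₀‖ ^ 2 := by positivity
  have hB₁ : ((κ : ℝ) : ℂ) * (((m : ℝ) : ℂ) * (φ₀ * conj φ₀)) = ((κ * m * ‖φ₀‖ ^ 2 : ℝ) : ℂ) := by rw [hnorm]; push_cast; ring
  have hB₃ : ((κ : ℝ) : ℂ) * (((m : ℝ) : ℂ) * (c z * φ₀ * conj φ₀)) = conj (((κ : ℝ) : ℂ) * (((m : ℝ) : ℂ) * (φ₀ * conj (c z * φ₀)))) := by
    simp only [map_mul, Complex.conj_conj, Complex.conj_ofReal]; ring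
  have hB₄ : ((κ : ℝ) : ℂ) * (((m : ℝ) : ℂ) * (c z * φ₀ * conj (c z * φ₀))) = ((κ * m * ‖c z‖ ^ 2 * ‖φ₀‖ ^ 2 : ℝ) : ℂ) := by
    have h2 : c z * φ₀ * conj (c z * φ₀) = ((‖c z * φ₀‖ ^ 2 : ℝ) : ℂ) := by rw [Complex.mul_conj, Complex.normSq_eq_norm_sq]
    rw [h2, norm_mul, mul_pow]; push_cast; ring
  have hW : ‖((κ : ℝ) : ℂ) * (((m : ℝ) : ℂ) * (φ₀ * conj (c z * φ₀)))‖ ^ 2 ≤ (κ * m * ‖φ₀‖ ^ 2) * (κ * m * ‖c z‖ ^ 2 * ‖φ₀‖ ^ 2) := by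
    rw [norm_mul, norm_mul, norm_mul, Complex.norm_conj, norm_mul, Complex.norm_real, Complex.norm_real, Real.norm_of_nonneg hκ.le, Real.norm_of_nonneg hm.le]
    nlinarith [norm_nonneg φ₀, norm_nonneg (c z), sq_nonneg (κ * m * ‖φ₀‖ * ‖c z‖ * ‖φ₀‖)]
  have hfour : (((Q z : ℝ)) : ℂ) = ((cμ : ℝ) : ℂ) * (((K : ℝ) : ℂ) *
      ((((T : ℝ) : ℂ) ^ (z + conj z - 2) / (z + conj z - 2)) * (((κ : ℝ) : ℂ) * (((m : ℝ) : ℂ) * (φ₀ * conj φ₀)))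
        + (((T : ℝ) : ℂ) ^ (z - conj z) / (z - conj z)) * (((κ : ℝ) : ℂ) * (((m : ℝ) : ℂ) * (φ₀ * conj (c z * φ₀))))
        - (((T : ℝ) : ℂ) ^ (-(z - conj z)) / (z - conj z)) * (((κ : ℝ) : ℂ) * (((m : ℝ) : ℂ) * (c z * φ₀ * conj φ₀)))
        - (((T : ℝ) : ℂ) ^ (-(z + conj z - 2)) / (z + conj z - 2)) * (((κ : ℝ) : ℂ) * (((m : ℝ) : ℂ) * (c z * φ₀ * conj (c z * φ₀)))))) := hdiag
  exact poleControl_of_fourTerm hcμ hK hT hx hy hQ0 ha hb hW hs₁ hs₂ hB₁ hB₃ hB₄ hfour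

end Head

/-! ## §4 The LOWER quadrant `D⁻ = {Re z > 1, Im z < 0}` by Schwarz reflection (twin of ★ p858922) -/

section Lower

/-- `conj` maps `D⁺` into `D⁻`. [folklore] -/
theorem conj_mem_lowerQuadrant_one {u : ℂ} (hu : u ∈ {z : ℂ | 1 < z.re ∧ 0 < z.im}) : conj u ∈ {w : ℂ | 1 < w.re ∧ w.im < 0} := by
  obtain ⟨h1, h2⟩ := hu
  refine ⟨?_, ?_⟩
  · show 1 < (conj u).re
    rw [Complex.conj_re]; exact h1
  · show (conj u).im < 0
    rw [Complex.conj_im]; linarith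

/-- `conj` maps `D⁻` into `D⁺`. [folklore] -/
theorem conj_mem_upperQuadrant_one {w : ℂ} (hw : w ∈ {w : ℂ | 1 < w.re ∧ w.im < 0}) : conj w ∈ {z : ℂ | 1 < z.re ∧ 0 < z.im} := by
  obtain ⟨h1, h2⟩ := hw
  refine ⟨?_, ?_⟩
  · show 1 < (conj w).re
    rw [Complex.conj_re]; exact h1
  · show 0 < (conj w).im
    rw [Complex.conj_im]; linarith





/-- **POLE CONTROL OF THE CONTINUED `c̃` ON `D⁻ = {Re z > 1, Im z < 0}`, MODULO THE PAIRING** — the lower-quadrant twin of §3 `poleControl_continued_cm_three_of_pairing`.  Let `T ≥ 1`,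
`cμ, K, κ, m > 0`, `φ₀ ≠ 0`; `c̃` holomorphic on `D⁻`; `Φ : ℂ → ℂ → ℂ` with `z ↦ Φ z z′` holomorphic on `D⁻` (`z′ ∈ D⁻`), `w ↦ Φ z (conj w)` holomorphic on `D⁺` (`z ∈ D⁻`), `Φ = R(·,·; c̃)`
(the four-term right side of ★ (R6k)₃, verbatim as in §3) on the sub-tube `2 < Re z′ < Re z` inside `D⁻ × D⁻`, and `Φ z z = Q z ≥ 0` on `D⁻`.  Then at every `z ∈ D⁻`, with `x = Re z − 1`,
`y = Im z`, `a = κm|φ₀|²`, `b = κm|c̃ z|²|φ₀|²`: (a1) `√b ≤ x T^{2x} √a∕|y| + √(x²T^{4x}a∕y² + aT^{4x})`, (a2) the box bound on `x ∈ [x₁,x₂]`, `|y| ≥ η`, (a3) `b ≤ (…)²∕y²` for `|y| ≤ 1`.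
PROOF: apply §3 at `conj z ∈ D⁺` to the reflected data `c♭ = conj ∘ c̃ ∘ conj`, `Φ♭(u,u′) = conj Φ(conj u, conj u′)`, `φ₀♭ = conj φ₀`, `Q♭ = Q ∘ conj` (Schwarz reflection ★
`differentiableOn_conj_comp_conj`; `conj R(conj u, conj u′; c̃, φ₀) = R(u,u′; c♭, φ₀♭)` by ★ `conj_ofReal_cpow`), and read the conclusions back through `Re conj z = Re z`, `|Im conj z| = |Im z|`,
`‖conj ·‖ = ‖·‖`. [cite: MoeglinWaldspurger1995, IV.3.12 (a)] [cite: Garrett2018, §11.3] -/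
theorem poleControl_continued_cm_three_of_pairing_lower {T cμ K κ m : ℝ} (hT : 1 ≤ T) (hcμ : 0 < cμ) (hK : 0 < K) (hκ : 0 < κ) (hm : 0 < m) {φ₀ : ℂ} (hφ₀ : φ₀ ≠ 0)
    {c : ℂ → ℂ} (hc : DifferentiableOn ℂ c {w : ℂ | 1 < w.re ∧ w.im < 0})
    {Φ : ℂ → ℂ → ℂ}
    (hΦ₁ : ∀ z' ∈ {w : ℂ | 1 < w.re ∧ w.im < 0}, DifferentiableOn ℂ (fun z : ℂ => Φ z z') {w : ℂ | 1 < w.re ∧ w.im < 0})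
    (hΦ₂ : ∀ z ∈ {w : ℂ | 1 < w.re ∧ w.im < 0}, DifferentiableOn ℂ (fun w : ℂ => Φ z (conj w)) {z : ℂ | 1 < z.re ∧ 0 < z.im})
    (hrel : ∀ z ∈ {w : ℂ | 1 < w.re ∧ w.im < 0}, ∀ z' ∈ {w : ℂ | 1 < w.re ∧ w.im < 0}, 2 < z'.re → z'.re < z.re →
      Φ z z' = ((cμ : ℝ) : ℂ) * (((K : ℝ) : ℂ) *
        ((((T : ℝ) : ℂ) ^ (z + conj z' - 2) / (z + conj z' - 2)) * (((κ : ℝ) : ℂ) * (((m : ℝ) : ℂ) * (φ₀ * conj φ₀)))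
          + (((T : ℝ) : ℂ) ^ (z - conj z') / (z - conj z')) * (((κ : ℝ) : ℂ) * (((m : ℝ) : ℂ) * (φ₀ * conj (c z' * φ₀))))
          - (((T : ℝ) : ℂ) ^ (-(z - conj z')) / (z - conj z')) * (((κ : ℝ) : ℂ) * (((m : ℝ) : ℂ) * (c z * φ₀ * conj φ₀)))
          - (((T : ℝ) : ℂ) ^ (-(z + conj z' - 2)) / (z + conj z' - 2)) * (((κ : ℝ) : ℂ) * (((m : ℝ) : ℂ) * (c z * φ₀ * conj (c z' * φ₀)))))))
    {Q : ℂ → ℝ} (hQ : ∀ z ∈ {w : ℂ | 1 < w.re ∧ w.im < 0}, 0 ≤ Q z ∧ Φ z z = ((Q z : ℝ) : ℂ))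
    {z : ℂ} (hz : z ∈ {w : ℂ | 1 < w.re ∧ w.im < 0}) :
    Real.sqrt (κ * m * ‖c z‖ ^ 2 * ‖φ₀‖ ^ 2) ≤ (z.re - 1) * T ^ (2 * (z.re - 1)) * Real.sqrt (κ * m * ‖φ₀‖ ^ 2) / |z.im| +
        Real.sqrt ((z.re - 1) ^ 2 * T ^ (4 * (z.re - 1)) * (κ * m * ‖φ₀‖ ^ 2) / z.im ^ 2 + (κ * m * ‖φ₀‖ ^ 2) * T ^ (4 * (z.re - 1))) ∧
      (∀ {x₁ x₂ η : ℝ}, 0 < x₁ → (z.re - 1) ∈ Set.Icc x₁ x₂ → 0 < η → η ≤ |z.im| →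
        κ * m * ‖c z‖ ^ 2 * ‖φ₀‖ ^ 2 ≤ (x₂ * T ^ (2 * x₂) * Real.sqrt (κ * m * ‖φ₀‖ ^ 2) / η + Real.sqrt (x₂ ^ 2 * T ^ (4 * x₂) * (κ * m * ‖φ₀‖ ^ 2) / η ^ 2 + (κ * m * ‖φ₀‖ ^ 2) * T ^ (4 * x₂))) ^ 2) ∧
      (|z.im| ≤ 1 → κ * m * ‖c z‖ ^ 2 * ‖φ₀‖ ^ 2 ≤ ((z.re - 1) * T ^ (2 * (z.re - 1)) * Real.sqrt (κ * m * ‖φ₀‖ ^ 2) +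
        Real.sqrt ((z.re - 1) ^ 2 * T ^ (4 * (z.re - 1)) * (κ * m * ‖φ₀‖ ^ 2) + (κ * m * ‖φ₀‖ ^ 2) * T ^ (4 * (z.re - 1)))) ^ 2 / z.im ^ 2) := by
  have hTc : ∀ s : ℂ, conj (((T : ℝ) : ℂ) ^ s) = ((T : ℝ) : ℂ) ^ (conj s) := fun s => K2E1MaassSelbergPoleControl.conj_ofReal_cpow (lt_of_lt_of_le one_pos hT) s
  -- (1) the reflected data on `D⁺`
  have hcr : DifferentiableOn ℂ (fun u : ℂ => conj (c (conj u))) {z : ℂ | 1 < z.re ∧ 0 < z.im} :=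
    (differentiableOn_conj_comp_conj isOpen_lowerQuadrant_one hc).mono fun u hu => conj_mem_lowerQuadrant_one hu
  have hΦ₁r : ∀ u' ∈ {z : ℂ | 1 < z.re ∧ 0 < z.im}, DifferentiableOn ℂ (fun u : ℂ => conj (Φ (conj u) (conj u'))) {z : ℂ | 1 < z.re ∧ 0 < z.im} := fun u' hu' =>
    (differentiableOn_conj_comp_conj isOpen_lowerQuadrant_one (hΦ₁ (conj u') (conj_mem_lowerQuadrant_one hu'))).mono fun u hu => conj_mem_lowerQuadrant_one hu
  have hΦ₂r : ∀ u ∈ {z : ℂ | 1 < z.re ∧ 0 < z.im}, DifferentiableOn ℂ (fun w : ℂ => conj (Φ (conj u) (conj (conj w)))) {w : ℂ | 1 < w.re ∧ w.im < 0} := fun u hu =>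
    (differentiableOn_conj_comp_conj isOpen_upperQuadrant_one (hΦ₂ (conj u) (conj_mem_lowerQuadrant_one hu))).mono fun w hw => conj_mem_upperQuadrant_one hw
  have hrelr : ∀ u ∈ {z : ℂ | 1 < z.re ∧ 0 < z.im}, ∀ u' ∈ {z : ℂ | 1 < z.re ∧ 0 < z.im}, 2 < u'.re → u'.re < u.re →
      conj (Φ (conj u) (conj u')) = ((cμ : ℝ) : ℂ) * (((K : ℝ) : ℂ) *
        ((((T : ℝ) : ℂ) ^ (u + conj u' - 2) / (u + conj u' - 2)) * (((κ : ℝ) : ℂ) * (((m : ℝ) : ℂ) * (conj φ₀ * conj (conj φ₀))))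
          + (((T : ℝ) : ℂ) ^ (u - conj u') / (u - conj u')) * (((κ : ℝ) : ℂ) * (((m : ℝ) : ℂ) * (conj φ₀ * conj (conj (c (conj u')) * conj φ₀))))
          - (((T : ℝ) : ℂ) ^ (-(u - conj u')) / (u - conj u')) * (((κ : ℝ) : ℂ) * (((m : ℝ) : ℂ) * (conj (c (conj u)) * conj φ₀ * conj (conj φ₀))))
          - (((T : ℝ) : ℂ) ^ (-(u + conj u' - 2)) / (u + conj u' - 2)) * (((κ : ℝ) : ℂ) * (((m : ℝ) : ℂ) * (conj (c (conj u)) * conj φ₀ * conj (conj (c (conj u')) * conj φ₀)))))) := by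
    intro u hu u' hu' h1 h2
    rw [hrel (conj u) (conj_mem_lowerQuadrant_one hu) (conj u') (conj_mem_lowerQuadrant_one hu') (by rw [Complex.conj_re]; exact h1) (by rw [Complex.conj_re, Complex.conj_re]; exact h2)]
    simp only [map_mul, map_sub, map_add, map_div₀, map_neg, map_ofNat, Complex.conj_ofReal, Complex.conj_conj, hTc]
  have hQr : ∀ u ∈ {z : ℂ | 1 < z.re ∧ 0 < z.im}, 0 ≤ Q (conj u) ∧ conj (Φ (conj u) (conj u)) = ((Q (conj u) : ℝ) : ℂ) := fun u hu => by
    obtain ⟨h0, heq⟩ := hQ (conj u) (conj_mem_lowerQuadrant_one hu)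
    exact ⟨h0, by rw [heq, Complex.conj_ofReal]⟩
  -- (2) §3 at `conj z ∈ D⁺`, read back
  have hmain := poleControl_continued_cm_three_of_pairing hT hcμ hK hκ hm (φ₀ := conj φ₀) ((map_ne_zero_iff _ (RingHom.injective _)).2 hφ₀)
    (c := fun u : ℂ => conj (c (conj u))) hcr (Φ := fun u u' : ℂ => conj (Φ (conj u) (conj u'))) hΦ₁r hΦ₂r hrelr (Q := fun u : ℂ => Q (conj u)) hQr
    (z := conj z) (conj_mem_upperQuadrant_one hz)
  simpa only [Complex.conj_re, Complex.conj_im, abs_neg, neg_sq, Complex.conj_conj, Complex.norm_conj] using hmain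

end Lower


end Summit.HodgeConjecture.HodgeConjecture.Cruxes.H413.K2E1MaassSelbergContinuedCMThree

end
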